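import Summits.BirchSwinnertonDyer.BirchSwinnertonDyer.Theorems.QuadraticBranchSignedControlPlusEtaNonsurjThetaFunctionalEquationNormCoordinateBranch
import Summits.BirchSwinnertonDyer.Rank1Residual.X2.AnalyticInvariants
import HarnessLib

/-!
# Route `QuadraticBranchSignedControl` (rung K8, cell `bsd-potss`), residual crux `PlusEtaMainConjectureNonsurj`
# (stmt-BirchSwinnertonDyer-19606): THE FUNCTIONAL EQUATION ON THE QUADRATIC BRANCH, XXV — THE IWASAWA INVARIANTS IN THE NORM
# COORDINATE: for `M = (1+T)^{−e/2}·S^{r₀}·N(Z)` (every nonzero solution of `ι M = w(1+T)^e M`, Part XXIV):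
# **`μ(M) = μ(N)` and `λ(M) = ord_T M + 2·λ(N)`** (seat `bsd-potss-k8eta-c2` g30; kernel, class-wide, fact-free)

WHY. Part XXIV wrote every nonzero solution of the functional equation — in particular every `L_p^±(V, η, X)` of the crux — as
`M = (1+T)^{er}·S^{r₀}·N(Z)` with `S = T(1+T)^r` (`2r = −1`), `Z = T + ιT = T² − T³ + ⋯`, `r₀ = ord_T M`, `N(0) ≠ 0`. The substitution
`H ↦ H(Z)` DOUBLES Weierstrass degrees (`Z` has order `2` and reduces mod `p` to a series of order `2`) and does not touch `p`-contents, while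
`(1+T)^{er}` is a unit and `S` has `μ = 0`, `λ = 1`. Hence the Iwasawa invariants of `M` are read off the norm-coordinate series `N`:
**`μ(M) = μ(N)`, `λ(M) = r₀ + 2·λ(N)`** — `λ(N)` is the number of `ι`-ORBITS `{c, c^ι}` of nonzero roots of the Weierstrass polynomial
(counted with multiplicity), the structural reason behind Part V/XII's parity law `λ ≡ ord_T (mod 2)` (re-derived here hypothesis-free from
the decomposition) and behind Part XVII's shapes (`λ = r₀ + 2` is `λ(N) = 1`: ONE orbit, `P = T^{r₀}(T² + aT + a) = T^{r₀}(1+T)(Z + a)`).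

MATHEMATICS. (§71, any domain `R`) if `a ∈ R⟦X⟧` has `a₀ = a₁ = 0 ≠ a₂` then `ord(H(a)) = 2·ord H` and `H(a)(0) = H(0)`. (§72) reduction
mod `p` commutes with substitution (Mathlib `PowerSeries.map_subst`); `Z mod p` has `a₀ = a₁ = 0`, `a₂ = 1`. (§73) `μ(N(Z)) = μ(N)`,
`pfree(N(Z)) = pfree(N)(Z)`, `λ(N(Z)) = 2λ(N)` (the tree's `mu_eq_and_pfree_eq`); `μ(T) = 0`, `λ(T) = 1`; `μ = λ = 0` for units; so
`μ(S^n) = 0`, `λ(S^n) = n` (`mu_mul`, `lam_mul`). (§74) `μ`/`λ` of `(1+T)^a·S^n·N(Z)`; with Part XXIV: for `M ≠ 0`, `ι M = w(1+T)^e M`: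
`∃ N`, `N(0) ≠ 0`, `M = (1+T)^{er}S^{r₀}N(Z)`, `μ(M) = μ(N)`, `λ(M) = r₀ + 2λ(N)`; hence `ord_T M ≤ λ(M)`, `2 ∣ λ(M) − ord_T M`. (§75) every
nonzero `L_p^±(V, η, X)` (any period ratio): the same, with `e = c + b` / `c + a`.

WHAT. §71 `subst_C_eq'`, `constantCoeff_subst_eq'`, `order_eq_two_of_coeff`, **`order_subst_eq_two_mul_order`**; §72 `red_subst_trace`,
`constantCoeff_red_trace`, `coeff_one_red_trace`, `coeff_two_red_trace`; §73 **`mu_subst_trace_eq`** (with `pfree`), **`lam_subst_trace_eq`**,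
`isUnit_binomialSeries'`, `mu_lam_sqrtZ_pow` (with the tree's `X2.lam_X`, `mu_eq_zero_of_isUnit`, `ParitySqueeze.lam_eq_zero_of_isUnit`); §74 **`mu_normCoordinate`**,
**`lam_normCoordinate`**, **`exists_normCoordinate_mu_lam_of_invol_eq`**, `order_le_lam_of_invol_eq`, `two_dvd_lam_sub_order_of_invol_eq`;
§75 `exists_normCoordinate_mu_lam_of_isQuadraticBranch{Plus,Minus}LFunction`, `order_le_lam_and_two_dvd_of_isQuadraticBranch{Plus,Minus}LFunction`.

HONEST FRAMING (cell `bsd-potss`; FULL-BSD rank ≤ 1 programme, HUMAN RULING D-0036/D-0074): TOOL THEOREMS ONLY — no definition, no named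
fact, no `sorry`, axioms standard; `μ`, `λ` are the tree's `X1.MuLambda.mu/lam` of a power series; nothing about (A), (C1⁺_η), C-cc-1 or
`BSD(W,p)` of any pair is claimed; no stub of 19606 is proved; crux and route OPEN; nothing booked. `--supports stmt-BirchSwinnertonDyer-19606`.

References: [Washington1997] §7.1 (Thm. 7.3, `μ`, `λ`), §13.2; [MazurTateTeitelbaum1986Invent] §I.17; [GreenbergLNM1716] §1 (pp. 67–68);
[Sprung2017] Cor. 4.14; [Pollack2003] Thm. 5.13, §6. Tree: Parts XXIII–XXIV; `Rank1Residual/X1/MuLambdaAlgebra` (`mu`, `lam`, `pfree`, `red`,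
`mu_eq_and_pfree_eq`, `mu_mul`, `lam_mul`, `isUnit_iff_mu_eq_zero_and_lam_eq_zero`); Mathlib `PowerSeries.map_subst`, `PowerSeries.divXPowOrder`.
-/

set_option autoImplicit false
set_option linter.dupNamespace false
noncomputable section

open scoped Classical MatrixGroups ModularForm Topology

open PowerSeries CongruenceSubgroup Literature.NumberTheory.EllipticCurves Literature.NumberTheory.EllipticCurves.ModularForms
open Literature.NumberTheory.EllipticCurves.IwasawaAlgebra
open Summit.BirchSwinnertonDyer.Rank1Residual.Additive
open Summit.BirchSwinnertonDyer.Rank1Residual.X1.MuLambda (mu lam pfree red eq_C_pow_mu_mul_pfree red_pfree_ne_zero mu_eq_and_pfree_eq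
  mu_mul lam_mul pfree_ne_zero)
open Summit.BirchSwinnertonDyer.Rank1Residual.X1.ParitySqueeze (lam_eq_zero_of_isUnit)
open Summit.BirchSwinnertonDyer.Rank1Residual.X2 (mu_X_eq_zero_and_pfree_X lam_X mu_eq_zero_of_isUnit)

namespace Summit.BirchSwinnertonDyer.BirchSwinnertonDyer.Theorems.EtaThetaFunctionalEquation

/-! ## §71 Substituting a series of order exactly `2` doubles orders (any domain) -/

section Generic

variable {R : Type*} [CommRing R]

/-- Substitution fixes constants (any coefficient ring). [folklore] -/
theorem subst_C_eq' (a : PowerSeries R) (c : R) : PowerSeries.subst a (C c : PowerSeries R) = C c := by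
  rw [PowerSeries.subst_C]
  rfl

/-- `H(a)(0) = H(0)` when `a(0) = 0` (any coefficient ring). [folklore] -/
theorem constantCoeff_subst_eq' {a : PowerSeries R} (ha0 : constantCoeff a = 0) (H : PowerSeries R) :
    constantCoeff (PowerSeries.subst a H : PowerSeries R) = constantCoeff H := by
  have ha : HasSubst a := HasSubst.of_constantCoeff_zero' ha0
  conv_lhs => rw [eq_X_mul_shift_add_const H]
  rw [subst_add ha, subst_mul ha, subst_X ha, subst_C_eq', map_add, map_mul, ha0, zero_mul, zero_add, constantCoeff_C]

/-- A series with `a₀ = a₁ = 0 ≠ a₂` has order exactly `2`. [folklore] -/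
theorem order_eq_two_of_coeff {a : PowerSeries R} (h0 : constantCoeff a = 0) (h1 : coeff 1 a = 0) (h2 : coeff 2 a ≠ 0) :
    PowerSeries.order a = 2 := by
  refine order_eq_nat.mpr ⟨h2, fun i hi ↦ ?_⟩
  interval_cases i
  · rw [coeff_zero_eq_constantCoeff, h0]
  · exact h1

variable [IsDomain R]

/-- **`ord(H(a)) = 2·ord(H)`** for `a` of order exactly `2` over a domain: `H = X^m·K`, `K(0) ≠ 0`, `H(a) = a^m·K(a)`, `K(a)(0) = K(0)`.
[cite: Washington1997, §7.1] -/
theorem order_subst_eq_two_mul_order {a : PowerSeries R} (h0 : constantCoeff a = 0) (h1 : coeff 1 a = 0) (h2 : coeff 2 a ≠ 0)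
    (H : PowerSeries R) : PowerSeries.order (PowerSeries.subst a H : PowerSeries R) = 2 * PowerSeries.order H := by
  have ha : HasSubst a := HasSubst.of_constantCoeff_zero' h0
  by_cases hH : H = 0
  · rw [hH, ← coe_substAlgHom ha, map_zero, order_zero, ENat.mul_top two_ne_zero]
  set m := (PowerSeries.order H).toNat with hm
  have hHm : H = X ^ m * divXPowOrder H := X_pow_order_mul_divXPowOrder.symm
  have hK0 : constantCoeff (divXPowOrder H) ≠ 0 := fun h ↦ hH (constantCoeff_divXPowOrder_eq_zero_iff.mp h)
  have hordK : PowerSeries.order (PowerSeries.subst a (divXPowOrder H) : PowerSeries R) = (0 : ℕ) := by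
    refine order_eq_nat.mpr ⟨?_, fun i hi ↦ (Nat.not_lt_zero i hi).elim⟩
    rw [coeff_zero_eq_constantCoeff, constantCoeff_subst_eq' h0]
    exact hK0
  have hL : PowerSeries.order (PowerSeries.subst a H : PowerSeries R) = ((m * 2 : ℕ) : ℕ∞) := by
    rw [hHm, subst_mul ha, subst_pow ha, subst_X ha, order_mul, order_pow, order_eq_two_of_coeff h0 h1 h2, hordK]
    simp only [nsmul_eq_mul, Nat.cast_zero, add_zero, Nat.cast_mul, Nat.cast_ofNat]
  rw [hL, ← coe_toNat_order hH, ← hm]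
  push_cast
  ring

end Generic

variable {p : ℕ} [hp : Fact p.Prime] {r : ℤ_[p]} {S Z : IwasawaAlgebra p}

/-! ## §72 Reduction mod `p` of the norm coordinate -/

/-- Reduction mod `p` commutes with the substitution of `Z`: `red(N(Z)) = (red N)(red Z)`. [folklore] -/
theorem red_subst_trace (hZ : Z = X + invol p X) (N : IwasawaAlgebra p) :
    red (PowerSeries.subst Z N) = PowerSeries.subst (red Z) (red N) :=
  map_subst (hasSubst_trace hZ) N

/-- `(red Z)(0) = 0`. [folklore] -/
theorem constantCoeff_red_trace (hZ : Z = X + invol p X) : constantCoeff (red Z) = 0 := by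
  rw [← coeff_zero_eq_constantCoeff, red, coeff_map, coeff_zero_eq_constantCoeff, hZ, constantCoeff_X_add_invol_X, map_zero]

/-- `coeff_1 (red Z) = 0`. [folklore] -/
theorem coeff_one_red_trace (hZ : Z = X + invol p X) : coeff 1 (red Z) = 0 := by
  rw [red, coeff_map, hZ, coeff_one_X_add_invol_X, map_zero]

/-- `coeff_2 (red Z) = 1 ≠ 0`: `Z` STAYS of order `2` modulo `p`. [folklore] -/
theorem coeff_two_red_trace (hZ : Z = X + invol p X) : coeff 2 (red Z) = 1 := by
  rw [red, coeff_map, hZ, coeff_two_X_add_invol_X, map_one]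

/-! ## §73 `μ(N(Z)) = μ(N)`, `λ(N(Z)) = 2λ(N)`; `μ(S) = 0`, `λ(S) = 1` -/

/-- **`μ(N(Z)) = μ(N)` and `pfree(N(Z)) = (pfree N)(Z)`**: substituting `Z` does not change `p`-contents (`N = p^μ N₀`, `N₀ ≢ 0 (p)` ⟹
`N(Z) = p^μ N₀(Z)`, `N₀(Z) ≢ 0 (p)` since `red(N₀(Z)) = (red N₀)(red Z)` has finite order `2·ord(red N₀)`). [cite: Washington1997, §7.1] -/
theorem mu_subst_trace_eq (hZ : Z = X + invol p X) {N : IwasawaAlgebra p} (hN : N ≠ 0) :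
    mu (PowerSeries.subst Z N) = mu N ∧ pfree (PowerSeries.subst Z N) = PowerSeries.subst Z (pfree N) := by
  refine mu_eq_and_pfree_eq (g₀ := PowerSeries.subst Z (pfree N)) ?_ ?_
  · intro h0
    have hord := order_subst_eq_two_mul_order (constantCoeff_red_trace hZ) (coeff_one_red_trace hZ)
      (by rw [coeff_two_red_trace hZ]; exact one_ne_zero) (red (pfree N))
    rw [← red_subst_trace hZ, h0, order_zero] at hord
    have hfin : PowerSeries.order (red (pfree N)) ≠ ⊤ := (order_finite_iff_ne_zero.mpr (red_pfree_ne_zero hN)).ne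
    exact WithTop.mul_ne_top (by decide) hfin hord.symm
  · conv_lhs => rw [eq_C_pow_mu_mul_pfree N]
    rw [subst_C_mul (hasSubst_trace hZ)]

/-- **`λ(N(Z)) = 2·λ(N)`**: the norm coordinate HALVES the Weierstrass degree. [cite: Washington1997, §7.1] -/
theorem lam_subst_trace_eq (hZ : Z = X + invol p X) {N : IwasawaAlgebra p} (hN : N ≠ 0) :
    lam (PowerSeries.subst Z N) = 2 * lam N := by
  have hfin : PowerSeries.order (red (pfree N)) ≠ ⊤ := (order_finite_iff_ne_zero.mpr (red_pfree_ne_zero hN)).ne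
  obtain ⟨n, hn⟩ := WithTop.ne_top_iff_exists.mp hfin
  rw [lam, lam, (mu_subst_trace_eq hZ hN).2, red_subst_trace hZ,
    order_subst_eq_two_mul_order (constantCoeff_red_trace hZ) (coeff_one_red_trace hZ)
      (by rw [coeff_two_red_trace hZ]; exact one_ne_zero), ← hn]
  norm_cast

/-- `(1+T)^a` is a unit of `Λ`. [folklore] -/
theorem isUnit_binomialSeries' (a : ℤ_[p]) : IsUnit (binomialSeries ℤ_[p] a : IwasawaAlgebra p) := by
  rw [PowerSeries.isUnit_iff_constantCoeff, binomialSeries_constantCoeff]; exact isUnit_one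

/-- **`μ(S^n) = 0` and `λ(S^n) = n`** for `S = T(1+T)^r`. [cite: Washington1997, §7.1] -/
theorem mu_lam_sqrtZ_pow (hS : S = X * binomialSeries ℤ_[p] r) (n : ℕ) : mu (S ^ n) = 0 ∧ lam (S ^ n) = n := by
  have hS0 := sqrtZ_ne_zero hS
  have hB := isUnit_binomialSeries' (p := p) r
  have hmuS : mu S = 0 := by
    rw [hS, mu_mul X_ne_zero hB.ne_zero, mu_X_eq_zero_and_pfree_X.1, mu_eq_zero_of_isUnit hB]
  have hlamS : lam S = 1 := by
    rw [hS, lam_mul X_ne_zero hB.ne_zero, lam_X, lam_eq_zero_of_isUnit hB]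
  induction n with
  | zero => exact ⟨mu_eq_zero_of_isUnit (by rw [pow_zero]; exact isUnit_one), lam_eq_zero_of_isUnit (by rw [pow_zero]; exact isUnit_one)⟩
  | succ n ih =>
    rw [pow_succ, mu_mul (pow_ne_zero n hS0) hS0, lam_mul (pow_ne_zero n hS0) hS0, ih.1, ih.2, hmuS, hlamS]
    exact ⟨rfl, rfl⟩

/-! ## §74 The invariants of `(1+T)^a · S^n · N(Z)` and of every nonzero solution of `ι M = w(1+T)^e M` -/

/-- **`μ((1+T)^a·S^n·N(Z)) = μ(N)`** (`N ≠ 0`). [cite: Washington1997, §7.1] -/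
theorem mu_normCoordinate (hS : S = X * binomialSeries ℤ_[p] r) (hZ : Z = X + invol p X) (a : ℤ_[p]) (n : ℕ)
    {N : IwasawaAlgebra p} (hN : N ≠ 0) :
    mu (binomialSeries ℤ_[p] a * S ^ n * PowerSeries.subst Z N) = mu N := by
  have hB := isUnit_binomialSeries' (p := p) a
  have hSn : S ^ n ≠ 0 := pow_ne_zero n (sqrtZ_ne_zero hS)
  have hNZ : (PowerSeries.subst Z N : IwasawaAlgebra p) ≠ 0 := fun h ↦ hN (subst_trace_injective hZ (by
    simp only [h, ← coe_substAlgHom (hasSubst_trace hZ), map_zero]))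
  rw [mu_mul (mul_ne_zero hB.ne_zero hSn) hNZ, mu_mul hB.ne_zero hSn, mu_eq_zero_of_isUnit hB, (mu_lam_sqrtZ_pow hS n).1,
    (mu_subst_trace_eq hZ hN).1, zero_add, zero_add]

/-- **`λ((1+T)^a·S^n·N(Z)) = n + 2·λ(N)`** (`N ≠ 0`). [cite: Washington1997, §7.1] -/
theorem lam_normCoordinate (hS : S = X * binomialSeries ℤ_[p] r) (hZ : Z = X + invol p X) (a : ℤ_[p]) (n : ℕ)
    {N : IwasawaAlgebra p} (hN : N ≠ 0) :
    lam (binomialSeries ℤ_[p] a * S ^ n * PowerSeries.subst Z N) = n + 2 * lam N := by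
  have hB := isUnit_binomialSeries' (p := p) a
  have hSn : S ^ n ≠ 0 := pow_ne_zero n (sqrtZ_ne_zero hS)
  have hNZ : (PowerSeries.subst Z N : IwasawaAlgebra p) ≠ 0 := fun h ↦ hN (subst_trace_injective hZ (by
    simp only [h, ← coe_substAlgHom (hasSubst_trace hZ), map_zero]))
  rw [lam_mul (mul_ne_zero hB.ne_zero hSn) hNZ, lam_mul hB.ne_zero hSn, lam_eq_zero_of_isUnit hB, (mu_lam_sqrtZ_pow hS n).2,
    lam_subst_trace_eq hZ hN, zero_add]

/-- **THE IWASAWA INVARIANTS OF A NONZERO SOLUTION OF `ι M = w·(1+T)^e·M` IN THE NORM COORDINATE**: with `r₀ = ord_T M` there is `N`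
with `N(0) ≠ 0`, `w = (−1)^{r₀}`, `M = (1+T)^{er}·S^{r₀}·N(Z)`, and **`μ(M) = μ(N)`, `λ(M) = r₀ + 2·λ(N)`** — `λ(N)` counts the `ι`-orbits
`{c, c^ι}` of nonzero roots. [cite: Washington1997, §7.1, §13.2] [cite: MazurTateTeitelbaum1986Invent, §I.17] [cite: GreenbergLNM1716, §1 (pp. 67–68)] -/
theorem exists_normCoordinate_mu_lam_of_invol_eq (hr : 2 * r = -1) (hS : S = X * binomialSeries ℤ_[p] r) (hZ : Z = X + invol p X)
    {M : IwasawaAlgebra p} (hM0 : M ≠ 0) {w e : ℤ_[p]} (hFE : invol p M = C w * binomialSeries ℤ_[p] e * M) :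
    ∃ N : IwasawaAlgebra p, constantCoeff N ≠ 0 ∧ w = (-1) ^ (PowerSeries.order M).toNat ∧
      M = binomialSeries ℤ_[p] (e * r) * S ^ (PowerSeries.order M).toNat * PowerSeries.subst Z N ∧
      mu M = mu N ∧ lam M = (PowerSeries.order M).toNat + 2 * lam N := by
  obtain ⟨N, hN0, hw, hM⟩ := exists_normCoordinate_of_invol_eq hr hS hZ hM0 hFE
  have hN : N ≠ 0 := fun h ↦ hN0 (by rw [h, map_zero])
  refine ⟨N, hN0, hw, hM, ?_, ?_⟩
  · conv_lhs => rw [hM]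
    exact mu_normCoordinate hS hZ _ _ hN
  · conv_lhs => rw [hM]
    exact lam_normCoordinate hS hZ _ _ hN

/-- **`ord_T M ≤ λ(M)`** for every nonzero solution of `ι M = w(1+T)^e M` (indeed `λ − ord_T = 2λ(N)`). [cite: Washington1997, §7.1] -/
theorem order_le_lam_of_invol_eq (hp2 : p ≠ 2) {M : IwasawaAlgebra p} (hM0 : M ≠ 0) {w e : ℤ_[p]}
    (hFE : invol p M = C w * binomialSeries ℤ_[p] e * M) : (PowerSeries.order M).toNat ≤ lam M := by
  obtain ⟨r, hr⟩ := exists_two_mul_eq_neg_one (p := p) hp2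
  obtain ⟨N, -, -, -, -, hlam⟩ := exists_normCoordinate_mu_lam_of_invol_eq hr rfl rfl hM0 hFE
  omega

/-- **`λ(M) ≡ ord_T M (mod 2)`** — Part V/XII's parity law, now from the decomposition: `λ(M) − ord_T M = 2λ(N)`.
[cite: Washington1997, §13.2] [cite: GreenbergLNM1716, §1 (pp. 67–68)] -/
theorem two_dvd_lam_sub_order_of_invol_eq (hp2 : p ≠ 2) {M : IwasawaAlgebra p} (hM0 : M ≠ 0) {w e : ℤ_[p]}
    (hFE : invol p M = C w * binomialSeries ℤ_[p] e * M) : 2 ∣ lam M - (PowerSeries.order M).toNat := by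
  obtain ⟨r, hr⟩ := exists_two_mul_eq_neg_one (p := p) hp2
  obtain ⟨N, -, -, -, -, hlam⟩ := exists_normCoordinate_mu_lam_of_invol_eq hr rfl rfl hM0 hFE
  exact ⟨lam N, by omega⟩

/-! ## §75 On the quadratic branch -/

section Branch

variable {N : ℕ} [NeZero N] {f : CuspForm (Gamma0 N) 2}

/-- **`μ(L) = μ(N)` and `λ(L) = ord_T L + 2·λ(N)` FOR EVERY NONZERO `L = L_p⁺(V, η, X)`** (`p` odd via `2r = −1`, `S = T(1+T)^r`,
`Z = T + ιT`; `f` a rational newform of level `N` prime to `p`, `a_p(f) = 0`, Fricke sign `σ`, `c` the `p`-adic exponent of `N`, `(p+1)b = −1`,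
ANY period ratio): `L = (1+T)^{(c+b)r}·S^{ord L}·N(Z)`, `N(0) ≠ 0`, `σ(−N|p) = (−1)^{ord L}`. [cite: Sprung2017, Cor. 4.14 (a_p = 0 display)]
[cite: MazurTateTeitelbaum1986Invent, §I.17] [cite: Kobayashi2003, Thm. 3.2, (3.4)] [cite: Pollack2003, Thm. 5.13] -/
theorem exists_normCoordinate_mu_lam_of_isQuadraticBranchPlusLFunction (hp2 : p ≠ 2) (hf0 : IsNewform0 f) (hQ : coeffField f = ⊥)
    (hpN : ¬ p ∣ N) (hap : cuspCoeff f p = ((0 : ℤ) : ℂ)) {σ : ℤ} (hσ : σ ^ 2 = 1)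
    (hW : atkinLehnerInvolution N 2 N f = (-(σ : ℂ)) • f)
    {ηN : rootsOfUnity (torsionOrder p) ℤ_[p]} {c : ℤ_[p]}
    (hc : ∀ n : ℕ, PadicInt.toZModPow (n + cyclotomicExponent p) ((ηN : ℤ_[p]ˣ) : ℤ_[p]) *
      (cyclotomicGenerator p : ZMod (p ^ (n + cyclotomicExponent p))) ^ (PadicInt.toZModPow n c).val =
        (N : ZMod (p ^ (n + cyclotomicExponent p))))
    {b : ℤ_[p]} (hb : ((p : ℤ_[p]) + 1) * b = -1)
    (hr : 2 * r = -1) (hS : S = X * binomialSeries ℤ_[p] r) (hZ : Z = X + invol p X)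
    {ϖ : ℚ} {L : IwasawaAlgebra p} (hL : IsQuadraticBranchPlusLFunction f p ϖ L) (hL0 : L ≠ 0) :
    ∃ Nn : IwasawaAlgebra p, constantCoeff Nn ≠ 0 ∧
      (((σ * legendreSym p (-(N : ℤ)) : ℤ) : ℤ_[p])) = (-1) ^ (PowerSeries.order L).toNat ∧
      L = binomialSeries ℤ_[p] ((c + b) * r) * S ^ (PowerSeries.order L).toNat * PowerSeries.subst Z Nn ∧
      mu L = mu Nn ∧ lam L = (PowerSeries.order L).toNat + 2 * lam Nn :=
  exists_normCoordinate_mu_lam_of_invol_eq hr hS hZ hL0 (invol_eq_of_isQuadraticBranchPlusLFunction hp2 hf0 hQ hpN hap hσ hW hc hb hL)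

/-- **`μ(L) = μ(N)` and `λ(L) = ord_T L + 2·λ(N)` FOR EVERY NONZERO `L = L_p⁻(V, η, X)`** (minus twin, `(p+1)a = −p`).
[cite: Sprung2017, Cor. 4.14 (a_p = 0 display)] [cite: MazurTateTeitelbaum1986Invent, §I.17] [cite: Kobayashi2003, Thm. 3.2, (3.5)] -/
theorem exists_normCoordinate_mu_lam_of_isQuadraticBranchMinusLFunction (hp2 : p ≠ 2) (hf0 : IsNewform0 f) (hQ : coeffField f = ⊥)
    (hpN : ¬ p ∣ N) (hap : cuspCoeff f p = ((0 : ℤ) : ℂ)) {σ : ℤ} (hσ : σ ^ 2 = 1)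
    (hW : atkinLehnerInvolution N 2 N f = (-(σ : ℂ)) • f)
    {ηN : rootsOfUnity (torsionOrder p) ℤ_[p]} {c : ℤ_[p]}
    (hc : ∀ n : ℕ, PadicInt.toZModPow (n + cyclotomicExponent p) ((ηN : ℤ_[p]ˣ) : ℤ_[p]) *
      (cyclotomicGenerator p : ZMod (p ^ (n + cyclotomicExponent p))) ^ (PadicInt.toZModPow n c).val =
        (N : ZMod (p ^ (n + cyclotomicExponent p))))
    {a : ℤ_[p]} (ha : ((p : ℤ_[p]) + 1) * a = -(p : ℤ_[p]))
    (hr : 2 * r = -1) (hS : S = X * binomialSeries ℤ_[p] r) (hZ : Z = X + invol p X)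
    {ϖ : ℚ} {L : IwasawaAlgebra p} (hL : IsQuadraticBranchMinusLFunction f p ϖ L) (hL0 : L ≠ 0) :
    ∃ Nn : IwasawaAlgebra p, constantCoeff Nn ≠ 0 ∧
      (((σ * legendreSym p (-(N : ℤ)) : ℤ) : ℤ_[p])) = (-1) ^ (PowerSeries.order L).toNat ∧
      L = binomialSeries ℤ_[p] ((c + a) * r) * S ^ (PowerSeries.order L).toNat * PowerSeries.subst Z Nn ∧
      mu L = mu Nn ∧ lam L = (PowerSeries.order L).toNat + 2 * lam Nn :=
  exists_normCoordinate_mu_lam_of_invol_eq hr hS hZ hL0 (invol_eq_of_isQuadraticBranchMinusLFunction hp2 hf0 hQ hpN hap hσ hW hc ha hL)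

/-- **`ord_T L ≤ λ(L)` and `λ(L) ≡ ord_T L (mod 2)` for every nonzero `L_p⁺(V, η, X)`, ANY period ratio, NO named fact** (the Fricke sign and the
`p`-adic exponent are discharged by `exists_frickeSign_of_isNewform0` / `exists_invol_eq_…`). [cite: Washington1997, §13.2] [cite: GreenbergLNM1716, §1] -/
theorem order_le_lam_and_two_dvd_of_isQuadraticBranchPlusLFunction (hp2 : p ≠ 2) (hf0 : IsNewform0 f) (hQ : coeffField f = ⊥)
    (hpN : ¬ p ∣ N) (hap : cuspCoeff f p = ((0 : ℤ) : ℂ)) {ϖ : ℚ} {L : IwasawaAlgebra p}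
    (hL : IsQuadraticBranchPlusLFunction f p ϖ L) (hL0 : L ≠ 0) :
    (PowerSeries.order L).toNat ≤ lam L ∧ 2 ∣ lam L - (PowerSeries.order L).toNat := by
  obtain ⟨σ, hσ, hW⟩ := exists_frickeSign_of_isNewform0 hf0
  obtain ⟨e, he⟩ := exists_invol_eq_of_isQuadraticBranchPlusLFunction hp2 hf0 hQ hpN hap hσ hW hL
  exact ⟨order_le_lam_of_invol_eq hp2 hL0 he, two_dvd_lam_sub_order_of_invol_eq hp2 hL0 he⟩

/-- Minus twin of `order_le_lam_and_two_dvd_of_isQuadraticBranchPlusLFunction`. [cite: Washington1997, §13.2] [cite: GreenbergLNM1716, §1] -/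
theorem order_le_lam_and_two_dvd_of_isQuadraticBranchMinusLFunction (hp2 : p ≠ 2) (hf0 : IsNewform0 f) (hQ : coeffField f = ⊥)
    (hpN : ¬ p ∣ N) (hap : cuspCoeff f p = ((0 : ℤ) : ℂ)) {ϖ : ℚ} {L : IwasawaAlgebra p}
    (hL : IsQuadraticBranchMinusLFunction f p ϖ L) (hL0 : L ≠ 0) :
    (PowerSeries.order L).toNat ≤ lam L ∧ 2 ∣ lam L - (PowerSeries.order L).toNat := by
  obtain ⟨σ, hσ, hW⟩ := exists_frickeSign_of_isNewform0 hf0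
  obtain ⟨e, he⟩ := exists_invol_eq_of_isQuadraticBranchMinusLFunction hp2 hf0 hQ hpN hap hσ hW hL
  exact ⟨order_le_lam_of_invol_eq hp2 hL0 he, two_dvd_lam_sub_order_of_invol_eq hp2 hL0 he⟩

end Branch

end Summit.BirchSwinnertonDyer.BirchSwinnertonDyer.Theorems.EtaThetaFunctionalEquation

end
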